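import Summits.BirchSwinnertonDyer.BirchSwinnertonDyer.Theorems.PrintCf2RubinValueTwoKatzFrameSupplyLinear
import Summits.BirchSwinnertonDyer.BirchSwinnertonDyer.Theorems.PrintCf2RubinValueTwoKatzPeriodRigidityOrigin
import Literature.NumberTheory.EllipticCurves.IntSeriesNodeTransportNoUnitContent
import Literature.NumberTheory.EllipticCurves.IntSeriesOnePlusPowMul
import Literature.NumberTheory.EllipticCurves.IntSeriesLinesRigidity
import HarnessLib

set_option linter.dupNamespace false
set_option autoImplicit false

/-!
# TWO-VARIABLE KATZ PERIOD RIGIDITY ON EVERY SUPPLY LINE (every prime `p`): the restrictions of two frames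
# of one branch at two period triples differ by a UNIT BINOMIAL TWIST `G'|_s = C₀·(1+T)^{ε + sδ}·G|_s` with
# ONE constant `C₀ = A^{a+b}B^b` and `p`-adic exponents AFFINE in the line index

Cell `bsd-print-cf2`, width seat `bsd-line-cf2c-w3` g5, route C `PrintCf2RubinValueTwo`, `--supports stmt-BirchSwinnertonDyer-23722`
(the «(R) period-rigidity» aside).  Theses-free; THEOREMS ONLY (no `def`, no named fact, no `sorry`); nothing is closed; BSD is not proved by
any of this; no summit statement is proved by this seat.

This is the LINE half of the FULL (ideal) period-rigidity theorem `G' = C₀·(1+T₁)^x(1+T₂)^w·G` (its two-variable assembly is the sequel).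
On B18's binder list, let `G ≠ 0` and `G'` solve de Shalit's frames of ONE branch at period triples `(Ω, δ, Ω_p)`, `(Ω', δ', Ω_p')`; let
`A = ι⁻¹(Ω/Ω')·Ω_p'/Ω_p`, `B = ι⁻¹(δ/δ')` (`‖A‖ = ‖B‖ = 1`, g4's `norm_periodRatio_eq_one`) and `C₀ = A^{a+b}B^b ∈ 𝒪_{ℂ_p}^×`.  Along the
supply lines `s` (`KatzFrameSupplyLinear.exists_frameSupply₂_lin`: directions `e(s) = p(s+s₀+1)·d − d′`, common node base `g`) the node values
satisfy `y = C₀·D_s^{t}·x` at `g^t − 1` (`t ≥ 1` from the frames, `t = 0` = the origin from g4's `value_origin_eq_periodRatio_pow_mul`), so the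
dense-valued node transport (`IntSeries.eq_C_mul_binomPow_mul_of_values_proportional`, p703543) gives `G'|_s = C₀·(1+T)^{z_s}·G|_s` and
`D_s = g^{z_s}` with `z_s ∈ ℤ_p` on every line with a non-zero node (lines with only zero nodes have `G|_s = G'|_s = 0`); since
`D_{s+1} = D_s·A^{NWp}` and `z ↦ g^z` is injective (`IntSeries.eq_of_onePlusPow_eq`), `z_s = ε + s·δ` with `g^δ = A^{NWp}`.

* **`exists_lineTwists_affine`** — THE STATEMENT: there are directions `e₁ e₂ : ℕ → ℤ_p` of the shape `e_i(s) = p(s+s₀+1)·d_i − d_i′`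
  (`d₁d₂′ ≠ d₂d₁′`, `e₂(s) ≠ 0`, pairwise non-proportional), a unit `c₀ ∈ 𝒪_{ℂ_p}` with `c₀ = A^{a+b}B^b`, and `ε, δ ∈ ℤ_p` such that for
  EVERY `s`: `monomialLine (e₁ s) (e₂ s) G' = C c₀ · binomPow (ε + s·δ) · monomialLine (e₁ s) (e₂ s) G`.

References: [deShalit1987] II.4.12 Remarks (iii)–(iv) (p. 66–67), II.4.16 (49)–(50), II.4.17 (52)–(54) (p. 77–78); [Gouvea1993PadicNumbers]
§5.9; [Robert2000PadicAnalysis] V.2.4, VI.2.1; [Washington1997] §5.1–§5.2, §13.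
-/

noncomputable section

open scoped NumberField Classical Topology
open Filter NumberField IsDedekindDomain Field
open Literature Literature.NumberTheory.GaloisRepresentations Literature.NumberTheory.EllipticCurves
open Summit.BirchSwinnertonDyer.Rank1Residual.X11b Summit.BirchSwinnertonDyer.BirchSwinnertonDyer.Theorems.PrintCf2
  Summit.BirchSwinnertonDyer.BirchSwinnertonDyer.Theorems.CycTangentCMCycTangentBoundPeriodRigidity

namespace Summit.BirchSwinnertonDyer.BirchSwinnertonDyer.Theorems.PrintCf2.KatzPeriodRigidity

variable {p : ℕ} [Fact p.Prime] {K : Type} [Field K] [NumberField K]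

/-- **PERIOD RIGIDITY ON EVERY SUPPLY LINE, WITH AFFINE EXPONENTS.** On B18's binder list, for two frames `G ≠ 0`, `G'` of one branch at two
period triples (all six periods non-zero) there are: supply directions `e_i(s) = p(s+s₀+1)·d_i − d_i′` (`d₁d₂′ ≠ d₂d₁′`, `e₂(s) ≠ 0`, pairwise
non-proportional), a unit `c₀` of `𝒪_{ℂ_p}` equal to `A^{a+b}B^b` (`A = ι⁻¹(Ω/Ω')·Ω_p'/Ω_p`, `B = ι⁻¹(δ/δ')`), and `ε, δ ∈ ℤ_p`, such that on
EVERY line `G'|_s = C c₀ · (1+T)^{ε + sδ} · G|_s` in `𝒪_{ℂ_p}⟦T⟧`.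
[cite: deShalit1987, II.4.12 Remarks (iii)–(iv) (p. 66–67), II.4.17 (52)–(54) (p. 77–78)] [cite: Gouvea1993PadicNumbers, §5.9 Lemma 5.9.1 and Problem 194] -/
theorem exists_lineTwists_affine (hK : IsImaginaryQuadratic K)
    {ι : PadicAlgCl p ≃+* ℂ} {v vbar : HeightOneSpectrum (𝓞 K)}
    (hv : ((p : ℕ) : 𝓞 K) ∈ v.asIdeal) (hvbar : ((p : ℕ) : 𝓞 K) ∈ vbar.asIdeal) (hne : vbar ≠ v)
    (hι : ∀ (w : InfinitePlace K) (d : 𝓞 K), d ∈ v.asIdeal ↔ ‖ι.symm (w.embedding (d : K))‖ < 1)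
    {S : Finset (HeightOneSpectrum (𝓞 K))}
    {η : HeckeCharacter K} {w₀ : ℕ} (hw₀ : 0 < w₀) (hη : η.HasInfinityType (fun _ ↦ (w₀ : ℤ)) (fun _ ↦ 0))
    {lam : HeckeCharacter K} {a b : ℕ} (hba : b ≤ a)
    (hlam : lam.HasInfinityType (fun _ ↦ -(a : ℤ)) (fun _ ↦ (b : ℤ)))
    (hlamu : ∀ w : HeightOneSpectrum (𝓞 K), w ∉ S → w ≠ vbar → lam.IsUnramifiedAt w)
    {κ₁ κ₂ : ZpExtension K p} {γ₁ γ₂ : absoluteGaloisGroup K}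
    (hpair : ZpExtension.IsTopGeneratorPair κ₁ κ₂ γ₁ γ₂)
    {Ω δ Ω' δ' : ℂ} {Ωp Ωp' : ℂ_[p]} {G G' : PowerSeries (PowerSeries (PadicComplexInt p))}
    (hG : IsKatzMeasure₂ ι v vbar S κ₁ κ₂ γ₁ γ₂ lam Ω δ Ωp G)
    (hG' : IsKatzMeasure₂ ι v vbar S κ₁ κ₂ γ₁ γ₂ lam Ω' δ' Ωp' G')
    (hΩ : Ω ≠ 0) (hδ : δ ≠ 0) (hΩp : Ωp ≠ 0) (hΩ' : Ω' ≠ 0) (hδ' : δ' ≠ 0) (hΩp' : Ωp' ≠ 0)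
    (hG0 : G ≠ 0) :
    ∃ (e₁ e₂ : ℕ → ℤ_[p]) (d₁ d₂ d₁' d₂' : ℤ_[p]) (s₀ : ℕ) (c₀ : PadicComplexInt p) (ε dz : ℤ_[p]),
      d₁ * d₂' ≠ d₂ * d₁' ∧
      (∀ s, e₁ s = ((p * (s + s₀ + 1) : ℕ) : ℤ_[p]) * d₁ - d₁') ∧
      (∀ s, e₂ s = ((p * (s + s₀ + 1) : ℕ) : ℤ_[p]) * d₂ - d₂') ∧
      (∀ s, e₂ s ≠ 0) ∧ (∀ s t, s ≠ t → e₁ s * e₂ t ≠ e₁ t * e₂ s) ∧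
      IsUnit c₀ ∧
      (c₀ : ℂ_[p]) = ((((ι.symm (Ω / Ω')) : PadicAlgCl p) : ℂ_[p]) * (Ωp' / Ωp)) ^ (a + b) *
        (((ι.symm (δ / δ')) : PadicAlgCl p) : ℂ_[p]) ^ b ∧
      ∀ s : ℕ, IntSeries.monomialLine (e₁ s) (e₂ s) G' =
        PowerSeries.C c₀ * IntSeries.binomPow (ε + (s : ℤ_[p]) * dz) * IntSeries.monomialLine (e₁ s) (e₂ s) G := by
  have hp : p.Prime := Fact.out
  obtain ⟨κF, γF, ρ, r, g, N, W, s₀, d₁, d₂, d₁', d₂', hN, hWpos, hdet, hκpair, hγ, hval1, hval2, hc₂, hprop,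
    hgsmall, hgne, hsup⟩ := exists_frameSupply₂_lin hK hv hvbar hne hι hw₀ hη hba hlam hlamu hpair
  have hp1 : ‖(p : ℂ_[p])‖ ≤ 1 := norm_prime_padicComplex_lt_one.le
  have hg1 : ‖g - 1‖ < 1 := hgsmall.trans_le hp1
  have hroot : ∀ n : ℕ, 0 < n → g ^ n ≠ 1 := IntSeries.forall_pow_ne_one_of_norm_sub_one_lt hgne hgsmall
  set aF : ℕ → ℕ := fun s ↦ p * (s + s₀ + 1) with haF
  set m : ℕ → ℕ → ℕ := fun s t ↦ a + N * (W * (aF s * (t + 1))) with hmdef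
  set j : ℕ → ℕ → ℕ := fun s t ↦ b + N * (W * (t + 1)) with hjdef
  have hL : ∀ s t, LFunction.HasEntireContinuation (heckeLFunction (lam * ρ s t)) := fun s t ↦ (hsup s t).2.2.2.2.2.2
  -- directions and lines
  set e₁ : ℕ → ℤ_[p] := fun s ↦ Multiplicative.toAdd (κF s γ₁) with he₁
  set e₂ : ℕ → ℤ_[p] := fun s ↦ Multiplicative.toAdd (κF s γ₂) with he₂
  set F : ℕ → PowerSeries (PadicComplexInt p) := fun s ↦ IntSeries.monomialLine (e₁ s) (e₂ s) G with hFdef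
  set F' : ℕ → PowerSeries (PadicComplexInt p) := fun s ↦ IntSeries.monomialLine (e₁ s) (e₂ s) G' with hF'def
  have hFbr : ∀ s, DeShalit1987.IsKatzBranch ι v vbar S (κF s) (γF s) lam Ω δ Ωp (F s) :=
    fun s ↦ hG.isKatzBranch_monomialLine (hκpair s) (hγ s)
  have hF'br : ∀ s, DeShalit1987.IsKatzBranch ι v vbar S (κF s) (γF s) lam Ω' δ' Ωp' (F' s) :=
    fun s ↦ hG'.isKatzBranch_monomialLine (hκpair s) (hγ s)
  -- node values at `g^{t+1} − 1`
  set x : ℕ → ℕ → ℂ_[p] := fun s t ↦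
    (((ι.symm (DeShalit1987.interpolationValue p v vbar S (lam * ρ s t) (m s t) (j s t) Ω δ
      ((hL s t).continuation 0))) : PadicAlgCl p) : ℂ_[p]) * Ωp ^ (m s t + j s t) with hxdef
  set y : ℕ → ℕ → ℂ_[p] := fun s t ↦
    (((ι.symm (DeShalit1987.interpolationValue p v vbar S (lam * ρ s t) (m s t) (j s t) Ω' δ'
      ((hL s t).continuation 0))) : PadicAlgCl p) : ℂ_[p]) * Ωp' ^ (m s t + j s t) with hydef
  have hxF : ∀ s t, IntSeries.HasValueAt (F s) (g ^ (t + 1) - 1) (x s t) := fun s t ↦ by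
    obtain ⟨hr, hκr, hrval, hinf, hjm, hunr, -⟩ := hsup s t
    rw [← hrval]
    exact hFbr s (ρ s t) (r s t) (m s t) (j s t) hr hκr hjm hinf hunr (hL s t)
  have hyF : ∀ s t, IntSeries.HasValueAt (F' s) (g ^ (t + 1) - 1) (y s t) := fun s t ↦ by
    obtain ⟨hr, hκr, hrval, hinf, hjm, hunr, -⟩ := hsup s t
    rw [← hrval]
    exact hF'br s (ρ s t) (r s t) (m s t) (j s t) hr hκr hjm hinf hunr (hL s t)
  -- the period ratios and the node law
  set A : ℂ_[p] := (((ι.symm (Ω / Ω')) : PadicAlgCl p) : ℂ_[p]) * (Ωp' / Ωp) with hAdef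
  set B : ℂ_[p] := (((ι.symm (δ / δ')) : PadicAlgCl p) : ℂ_[p]) with hBdef
  have hιne : ∀ z : ℂ, z ≠ 0 → (((ι.symm z) : PadicAlgCl p) : ℂ_[p]) ≠ 0 := fun z hz ↦ by
    rw [PadicComplex.coe_eq, map_ne_zero_iff _ (algebraMap (PadicAlgCl p) ℂ_[p]).injective,
      map_ne_zero_iff _ ι.symm.injective]
    exact hz
  have hA0 : A ≠ 0 := mul_ne_zero (hιne _ (div_ne_zero hΩ hΩ')) (div_ne_zero hΩp' hΩp)
  have hB0 : B ≠ 0 := hιne _ (div_ne_zero hδ hδ')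
  obtain ⟨hAn, hBn⟩ := norm_periodRatio_eq_one hK hv hvbar hne hι hw₀ hη hba hlam hlamu hpair hG hG' hΩ hδ hΩp hΩ' hδ' hΩp' hG0
  rw [← hAdef] at hAn
  rw [← hBdef] at hBn
  -- the constant `C₀ = A^{a+b} B^b`, a unit of `𝒪_{ℂ_p}`
  set C₀ : ℂ_[p] := A ^ (a + b) * B ^ b with hC₀def
  have hC₀n : ‖C₀‖ = 1 := by rw [hC₀def, norm_mul, norm_pow, norm_pow, hAn, hBn, one_pow, one_pow, one_mul]
  have hC₀0 : C₀ ≠ 0 := fun h ↦ by rw [h, norm_zero] at hC₀n; exact zero_ne_one hC₀n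
  set c₀ : PadicComplexInt p := ⟨C₀, mem_padicComplexInt_iff.mpr hC₀n.le⟩ with hc₀def
  have hc₀coe : (c₀ : ℂ_[p]) = C₀ := rfl
  have hc₀unit : IsUnit c₀ := isUnit_padicComplexInt_iff.mpr (by rw [hc₀coe, hC₀n])
  -- `A' = A^{NW}` and `D_s = A'^{p(s+s₀+1)+1} B^{NW}`
  set A' : ℂ_[p] := A ^ (N * W) with hA'def
  set D : ℕ → ℂ_[p] := fun s ↦ A' ^ (aF s + 1) * B ^ (N * W) with hDdef
  have hA'0 : A' ≠ 0 := pow_ne_zero _ hA0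
  have hD0 : ∀ s, D s ≠ 0 := fun s ↦ mul_ne_zero (pow_ne_zero _ hA'0) (pow_ne_zero _ hB0)
  have hxy : ∀ s t, y s t = C₀ * D s ^ (t + 1) * x s t := by
    intro s t
    rw [hydef, hxdef]
    simp only
    rw [padicValue_eq_periodRatio_pow_mul ι v vbar S _ (m s t) (j s t) Ω' δ' _ Ωp' hΩ hδ hΩp, ← hAdef, ← hBdef,
      hmdef, hjdef]
    simp only
    rw [hC₀def, hDdef, hA'def]
    ring
  have hDsucc : ∀ s k : ℕ, D (s + k) = D s * (A' ^ p) ^ k := by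
    intro s k
    rw [hDdef, hA'def]
    simp only [haF]
    ring
  -- zero lines are zero on both sides
  have hzero : ∀ s, (∀ t, x s t = 0) → F s = 0 := fun s hs ↦
    eq_zero_of_hasValueAt_nodes_zero (F s) hgne hgsmall fun t ↦ by simpa only [hs t] using hxF s t
  have hzero' : ∀ s, (∀ t, x s t = 0) → F' s = 0 := fun s hs ↦
    eq_zero_of_hasValueAt_nodes_zero (F' s) hgne hgsmall fun t ↦ by
      simpa only [hxy, hs t, mul_zero] using hyF s t
  -- the set of zero lines is finite (else `G = 0`)
  have hfin : {s : ℕ | ∀ t, x s t = 0}.Finite := by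
    by_contra hinf
    apply hG0
    set φ := Set.Infinite.natEmbedding _ (Set.not_finite.1 hinf) with hφ
    refine IntSeries.eq_zero_of_monomialLine_eq_zero G (fun n ↦ e₁ (φ n)) (fun n ↦ e₂ (φ n))
      (fun n ↦ hc₂ _) (fun n n' hnn' ↦ hprop _ _ fun h ↦ hnn' (φ.injective (Subtype.ext h))) fun n ↦ ?_
    exact hzero _ (φ n).2
  -- on a good line: the twist and `D_s = g^{z_s}`
  have hgood : ∀ s, (∃ t, x s t ≠ 0) →
      ∃ z : ℤ_[p], F' s = PowerSeries.C c₀ * IntSeries.binomPow z * F s ∧ D s = IntSeries.onePlusPow z (g - 1) := by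
    intro s ⟨t₀, ht₀⟩
    -- values at the origin
    have h1 : ∀ c : ℤ_[p], IntSeries.onePlusPow c (0 : ℂ_[p]) - 1 = 0 := fun c ↦ by
      rw [IntSeries.onePlusPow_at_zero, sub_self]
    have hF0 : IntSeries.HasValueAt₂ G 0 0 ((PowerSeries.constantCoeff (F s) : PadicComplexInt p) : ℂ_[p]) := by
      have h := IntSeries.hasValueAt_zero (F s)
      rw [hFdef, IntSeries.hasValueAt_monomialLine_iff _ _ G (by rw [norm_zero]; exact one_pos), h1, h1] at h
      exact h
    have hF'0 : IntSeries.HasValueAt₂ G' 0 0 ((PowerSeries.constantCoeff (F' s) : PadicComplexInt p) : ℂ_[p]) := by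
      have h := IntSeries.hasValueAt_zero (F' s)
      rw [hF'def, IntSeries.hasValueAt_monomialLine_iff _ _ G' (by rw [norm_zero]; exact one_pos), h1, h1] at h
      exact h
    have horigin := value_origin_eq_periodRatio_pow_mul hK hv hvbar hne hι hw₀ hη hba hlam hlamu hpair hG hG' hΩ hδ hΩp
      hΩ' hδ' hΩp' hG0 hF0 hF'0
    rw [← hAdef, ← hBdef, ← hC₀def] at horigin
    -- the node data through all `t ∈ ℕ` (node `t` = `g^t − 1`)
    set X : ℕ → ℂ_[p] := fun t ↦ Nat.casesOn t ((PowerSeries.constantCoeff (F s) : PadicComplexInt p) : ℂ_[p]) (x s)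
      with hXdef
    set X' : ℕ → ℂ_[p] := fun t ↦ Nat.casesOn t ((PowerSeries.constantCoeff (F' s) : PadicComplexInt p) : ℂ_[p]) (y s)
      with hX'def
    have hX : ∀ t, IntSeries.HasValueAt (F s) (g ^ t - 1) (X t) := by
      intro t
      cases t with
      | zero => rw [pow_zero, sub_self]; exact IntSeries.hasValueAt_zero (F s)
      | succ t => exact hxF s t
    have hX' : ∀ t, IntSeries.HasValueAt (F' s) (g ^ t - 1) (X' t) := by
      intro t
      cases t with
      | zero => rw [pow_zero, sub_self]; exact IntSeries.hasValueAt_zero (F' s)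
      | succ t => exact hyF s t
    have hrel : ∀ t, X' t = (c₀ : ℂ_[p]) * D s ^ t * X t := by
      intro t
      cases t with
      | zero => rw [hc₀coe, pow_zero, mul_one]; exact horigin
      | succ t => rw [hc₀coe]; exact hxy s t
    have h0 : X (t₀ + 1) ≠ 0 := ht₀
    exact IntSeries.eq_C_mul_binomPow_mul_of_values_proportional hg1 hroot (by rw [hc₀coe]; exact hC₀0) (hD0 s)
      hX hX' hrel (t₀ := t₀ + 1) h0
  choose! z hz using hgood
  -- two consecutive good lines
  obtain ⟨Nb, hNb⟩ := hfin.bddAbove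
  have hgoodN : ∀ s, Nb < s → ∃ t, x s t ≠ 0 := by
    intro s hs
    by_contra h
    push Not at h
    exact absurd (hNb h) (not_le.2 hs)
  set s₁ : ℕ := Nb + 1 with hs₁
  have hg₁ := hgoodN s₁ (by omega)
  have hg₂ := hgoodN (s₁ + 1) (by omega)
  set dz : ℤ_[p] := z (s₁ + 1) - z s₁ with hdz
  set ε : ℤ_[p] := z s₁ - (s₁ : ℤ_[p]) * dz with hε
  -- `g^dz = A'^p`
  have hgdz : IntSeries.onePlusPow dz (g - 1) = A' ^ p := by
    have h1 := (hz s₁ hg₁).2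
    have h2 := (hz (s₁ + 1) hg₂).2
    rw [hDsucc s₁ 1, pow_one] at h2
    rw [hdz, IntSeries.onePlusPow_sub _ _ hg1, ← h2, ← h1, mul_comm (D s₁) (A' ^ p), mul_assoc,
      mul_inv_cancel₀ (hD0 s₁), mul_one]
  -- affine exponents on good lines
  have haffine : ∀ s, (∃ t, x s t ≠ 0) → z s = ε + (s : ℤ_[p]) * dz := by
    intro s hs
    have hzs := (hz s hs).2
    have hz₁ := (hz s₁ hg₁).2
    rcases le_or_gt s₁ s with hle | hlt
    · obtain ⟨k, rfl⟩ := Nat.exists_eq_add_of_le hle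
      have hkey : IntSeries.onePlusPow (z (s₁ + k)) (g - 1) = IntSeries.onePlusPow (z s₁ + (k : ℤ_[p]) * dz) (g - 1) := by
        rw [← hzs, hDsucc, hz₁, ← hgdz, ← IntSeries.onePlusPow_natCast_mul k dz hg1, ← IntSeries.onePlusPow_add _ _ hg1]
      have := IntSeries.eq_of_onePlusPow_eq hgne hgsmall hkey
      rw [this, hε]; push_cast; ring
    · obtain ⟨k, hk⟩ := Nat.exists_eq_add_of_le hlt.le
      have hkey : IntSeries.onePlusPow (z s₁) (g - 1) = IntSeries.onePlusPow (z s + (k : ℤ_[p]) * dz) (g - 1) := by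
        rw [← hz₁, hk, hDsucc, hzs, ← hgdz, ← IntSeries.onePlusPow_natCast_mul k dz hg1, ← IntSeries.onePlusPow_add _ _ hg1]
      have := IntSeries.eq_of_onePlusPow_eq hgne hgsmall hkey
      rw [hε, this, hk]; push_cast; ring
  refine ⟨e₁, e₂, d₁, d₂, d₁', d₂', s₀, c₀, ε, dz, hdet, hval1, hval2, hc₂, hprop, hc₀unit,
    by rw [hc₀coe, hC₀def], fun s ↦ ?_⟩
  by_cases hs : ∃ t, x s t ≠ 0
  · rw [← haffine s hs]
    exact (hz s hs).1
  · push Not at hs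
    change F' s = _ * F s
    rw [hzero s hs, hzero' s hs, mul_zero]

end Summit.BirchSwinnertonDyer.BirchSwinnertonDyer.Theorems.PrintCf2.KatzPeriodRigidity

end
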